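import Summits.QuantumFields.YangMills.Theorems.UnitScaleTiltProp7OneFormAgmonBilinearExport
import HarnessLib

/-!
# Route `UnitScaleTilt`, crux K1 «MinimiserStabilityRegPr» (stmt-QuantumFields-19200), EX rows `h137kπ` ∕ `h137kΔ` ∕ `hCk` — **K-STOREY BRICK (K2b-δ₃)-B3 (px12 g17): THE BILINEAR
# CONJUGATION DEFECT `θ₂` AT THE BLOCK-DISTANCE EXPONENTIAL WEIGHTS, UNIFORMLY OVER THE FINE-LIPSCHITZ PHASE CLASS** — FILE B2 ✓∕⧗`Prop7OneFormAgmonBilinearExport.hVconj₂_of_letters_DeltaEtaSlot`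
# at `w = e^{φ}`: the weight rows (`hρ`, `hρQ`, `hwfar`) are THEOREMS of A2e ✓`Prop7OneFormAgmonWeights` (`readSet_ratio_exp_le`, `far_ratio_exp_le`) and A4 (`|e^{t} − 1| ≤ e^{θ} − 1`), so
# `θ₂` depends on the slope and the member letters `hk`∕`hQ` only — the bilinear twin of A2e ✓`hVconj_exp_of_letters` ∕ A2g ✓`hVconj_phaseClass_of_letters` (θ_V), with the SAME formula.

Cell `ym3-torus` (HUMAN RULING D-0037: SU(2) YM₃ on T³ is ladder rung R3 — NOT d = 4, NOT infinite volume, NOT a mass gap, NOT Clay).  Width seat `ym3-torus-px12` gen 17.  THEOREMS ONLY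
(0 `def`, 0 `sorry`, default heartbeats); `--supports stmt-QuantumFields-19200 --as helper`, count-neutral.  HONEST LABEL: instantiation; CONDITIONAL on `hk` (the EX row `h349`'s kernel text)
and `hQ`; nothing of (3.46)∕(3.132), `h137kπ`, `h137kΔ`, `hCk`, EX or 19200 is proved here.

WHAT IS PROVED (ns `Summit.QuantumFields.YangMills.Theorems.Prop7OneFormAgmonBilinearPhaseClass`; member `F`, `h : n ≤ K`, weights `c₀ cB`, coupling `a`, slot of record `DeltaEtaSlot`).
* ★★ `hVconj₂_exp_of_letters_DeltaEtaSlot` — `w = e^{φ}`, per-bond slope `θ`, fine-Lipschitz slope `μη`, reference sites in the source blocks, `0 < β ≤ 1`, `μ + β < μ′`: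
  `θ₂ = a·(2√κ²C_Q + κ²) + √2·Ck·(μde^{μd}∕β)·(d(L^d)^{K−n}(2(1+1∕(μ′−(μ+β))))³) + 32√2ε₀·d6^d·(1 + (1 + (e^{θ}−1))²)`, `κ² = 216(e^{μ(d+1)}−1)²(cB∕(c₀ℓ³))`.
* ★★★ `hVconj₂_phaseClass_of_letters` — for EVERY `φ` with `|φ x − φ x′| ≤ r·η·tdist x x′` (`0 ≤ r < μ′`), reference sites := block corners, `β := min 1 ((μ′−r)∕2)`:
  `θ₂(r) = a·(2√κ²C_Q + κ²) + √2·Ck·(r·d·e^{rd}∕β)·(d(L^d)^{K−n}(2(1+1∕(μ′−(r+β))))³) + 32√2ε₀·d6^d·(1 + e^{2r})` — THE SAME NUMBER AS A2g's `θ_V(r)`.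
HYP-SAT (★★OWNER RULING №42): as A2g (`hk` ⟸ ✓`kernelRow349_allMembers_exists` under Lift; `hQ` ⟸ ✓`norm_Qk_le_of_regPr`; the class row by A4b's `φ_v`); nothing eventual; no restatement.

References: T. Bałaban, CMP **99** (1985) 389–434 [Balaban1985BackgroundPropagators] (Thm 3.1 (3.46) p.398, (3.49) p.399, (3.132) p.422); CMP **98** (1985) 17–51 [Balaban1985Averaging] ((2) p.17);
S. Agmon, *Lectures on exponential decay* (Princeton 1982) Ch. 1 [Agmon1982].
-/

set_option autoImplicit false

noncomputable section

open scoped BigOperators Matrix.Norms.L2Operator InnerProductSpace ComplexConjugate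

namespace Summit.QuantumFields.YangMills.Theorems.Prop7OneFormAgmonBilinearPhaseClass

open Literature.MathematicalPhysics.QuantumFieldTheory.Balaban1983to89
open Literature.MathematicalPhysics.QuantumFieldTheory.Balaban1983to89.T3ContinuumYM3Torus
open T3SectALandauChart (eta eta_pos bgUnits formComp)
open T3PrintedRegularMinimiser (RegPr)
open T3PrintedRegularOrbits (sites_eq)
open T3LevelShift (bondShift)
open B11Eq103H1Complex (SiteL2K BondL2K)
open B5Eq118OneStroke (iterBlockOf)
open B3Taylor310LocalRemainder (tdist_comm)
open Summit.QuantumFields.YangMills.Theorems.Prop7SectET3Transport (periodsT3)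
open Summit.QuantumFields.YangMills.Theorems.Prop7SectET3HilbertLetters (W₂ toL2 toL2S DL2 DstarL2)
open Summit.QuantumFields.YangMills.Theorems.Prop7SectET3WilsonHessian (DeltaEta DeltaEtaSlot)
open Summit.QuantumFields.YangMills.Theorems.Prop7SectET3GaugeProjector (RS)
open Summit.QuantumFields.YangMills.Theorems.Prop7SectET3CurvedPropagators (laplaceA Qk)
open Summit.QuantumFields.YangMills.Theorems.Prop7BlockDistanceWeights (tdist_src_tgt_le_one)
open Summit.QuantumFields.YangMills.Theorems.Prop7OneFormAgmonWeights (readSet_ratio_exp_le far_ratio_exp_le)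
open Literature.MathematicalPhysics.QuantumFieldTheory.Balaban1983to89.Beta.CombesThomasForm (abs_exp_sub_one_le)
open Summit.QuantumFields.YangMills.Theorems.Prop7OneFormAgmonPhaseClass (beta_rows iterBlockOf_src_corner)
open Summit.QuantumFields.YangMills.Theorems.Prop7TwistedSliceGaugeOntoTower (eta_le_one)
open Summit.QuantumFields.YangMills.Theorems.Prop7OneFormAgmonBilinearExport (hVconj₂_of_letters_DeltaEtaSlot)

variable (F : T3Family) {n K : ℕ} (h : n ≤ K) (c₀ cB : ℝ) [Fact (0 < c₀)] [Fact (0 < cB)] {a : ℝ}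

/-- ★★ **THE BILINEAR LETTER AT `w = e^{φ}`, SLOT OF RECORD.**  `RegPr F n K ε₀ U₀` + routeR-w4's windows, `0 ≤ a`; a phase `φ` with the per-bond slope `|φ(b₊) − φ(b₋)| ≤ θ` and the
fine-Lipschitz row `|φ x − φ x′| ≤ μη·tdist x x′` (`0 ≤ μ`); reference sites `x_r(ĉ)` in the source blocks; `0 < β ≤ 1`, `μ + β < μ′`; the letters `hk` (`Ck`, `μ′`) and `hQ` (`C_Q`).  THEN B2's
bilinear letter holds at `Δx := DeltaEtaSlot` for the weight `e^{φ∘src}` with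
`θ₂ = a·(2√κ²C_Q + κ²) + √2·Ck·(μde^{μd}∕β)·(d(L^d)^{K−n}(2(1+1∕(μ′−(μ+β))))³) + 32√2ε₀·d6^d·(1 + (1 + (e^{θ} − 1))²)`, `κ² = 216(e^{μ(d+1)} − 1)²(cB∕(c₀ℓ³))`.
[cite: Balaban1985BackgroundPropagators, Thm 3.1 (3.46) p.398, (3.49) p.399, (3.132) p.422; Agmon1982, Ch. 1] -/
theorem hVconj₂_exp_of_letters_DeltaEtaSlot {ε₀ : ℝ} (hε₀ : 0 < ε₀) (hε : 10 ^ 10 * (F.L : ℝ) ^ 6 * ε₀ ≤ 1) (hε12 : 10 ^ 12 * (F.L : ℝ) ^ 3 * ε₀ ≤ 1)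
    (U₀ : GaugeField (F.P K) 0 (Matrix.specialUnitaryGroup (Fin 2) ℂ)) (hreg : RegPr F n K ε₀ U₀) (ha : 0 ≤ a)
    (φ : Site (F.P K) 0 → ℝ) {θ μ : ℝ} (hμ : 0 ≤ μ)
    (hφ : ∀ b : PBond (F.P K) 0, |φ b.tgt - φ b.src| ≤ θ)
    (hφ' : ∀ x x' : Site (F.P K) 0, |φ x - φ x'| ≤ μ * eta F n K * (Site.tdist x x' : ℝ))
    (xr : PBond (F.P n) 0 → Site (F.P K) 0) (hxr : ∀ c, iterBlockOf (K - n) (xr c) = (bondShift (sites_eq F n K h) c).src)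
    {β μ' Ck : ℝ} (hβ : 0 < β) (hβ1 : β ≤ 1) (hνμ : μ + β < μ') (hCk : 0 ≤ Ck)
    (hk : ∀ (b : PBond (F.P K) 0) (Z : Matrix (Fin 2) (Fin 2) ℂ) (bd : PBond (F.P K) 0),
      ‖(toL2 F K c₀).symm (DL2 F n K c₀ U₀ (DstarL2 F n K c₀ U₀ (toL2 F K c₀ (Pi.single b Z)) - RS F n K h c₀ cB U₀ (DstarL2 F n K c₀ U₀ (toL2 F K c₀ (Pi.single b Z))))) bd‖
        ≤ Ck * Real.exp (-(μ' * (Site.tdist (P := F.P K) (iterBlockOf (K - n) b.src) (iterBlockOf (K - n) bd.src) : ℝ))) * ‖Z‖)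
    {CQ : ℝ} (hQ : ∀ v : BondL2K ℂ 3 (periodsT3 F K) c₀ W₂, ‖Qk F n K h c₀ cB U₀ v‖ ≤ CQ * ‖v‖) :
    ∀ X' X'' : PBond (F.P K) 0 → Matrix (Fin 2) (Fin 2) ℂ,
      |RCLike.re ((⟪toL2 F K c₀ (fun b => Real.exp (φ b.src) • X' b),
              laplaceA F n K h c₀ cB a (DeltaEtaSlot F n K c₀) U₀ (toL2 F K c₀ (fun b => (Real.exp (φ b.src))⁻¹ • X'' b))⟫_ℂ
            - ∑ κ : Fin (F.P K).d, ⟪DL2 F n K c₀ U₀ (toL2S F K c₀ (formComp (fun b => Real.exp (φ b.src) • X' b) κ)),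
                DL2 F n K c₀ U₀ (toL2S F K c₀ (formComp (fun b => (Real.exp (φ b.src))⁻¹ • X'' b) κ))⟫_ℂ)
          - (⟪toL2 F K c₀ X', laplaceA F n K h c₀ cB a (DeltaEtaSlot F n K c₀) U₀ (toL2 F K c₀ X'')⟫_ℂ
            - ∑ κ : Fin (F.P K).d, ⟪DL2 F n K c₀ U₀ (toL2S F K c₀ (formComp X' κ)), DL2 F n K c₀ U₀ (toL2S F K c₀ (formComp X'' κ))⟫_ℂ))|
        ≤ (a * (2 * Real.sqrt (216 * (Real.exp (μ * ((F.P K).d + 1)) - 1) ^ 2 * (cB / (c₀ * ((F.L : ℝ) ^ (K - n)) ^ 3))) * CQ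
                  + 216 * (Real.exp (μ * ((F.P K).d + 1)) - 1) ^ 2 * (cB / (c₀ * ((F.L : ℝ) ^ (K - n)) ^ 3)))
              + Real.sqrt 2 * Ck * (μ * (F.P K).d * Real.exp (μ * (F.P K).d) / β)
                  * (((F.P K).d : ℝ) * ((((F.P K).L : ℝ) ^ (F.P K).d) ^ (K - n)) * (2 * (1 + 1 / (μ' - (μ + β)))) ^ 3)
              + 32 * Real.sqrt 2 * ε₀ * (((F.P K).d : ℝ) * (2 * 3) ^ (F.P K).d) * (1 + (1 + (Real.exp θ - 1)) ^ 2))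
          * ‖toL2 F K c₀ X'‖ * ‖toL2 F K c₀ X''‖ := by
  have hρ : ∀ b : PBond (F.P K) 0, |Real.exp (φ b.tgt) / Real.exp (φ b.src) - 1| ≤ Real.exp θ - 1 := fun b => by
    rw [← Real.exp_sub]; exact abs_exp_sub_one_le (hφ b)
  have hρ' : ∀ b : PBond (F.P K) 0, |Real.exp (φ b.src) / Real.exp (φ b.tgt) - 1| ≤ Real.exp θ - 1 := fun b => by
    rw [← Real.exp_sub]; exact abs_exp_sub_one_le (by rw [abs_sub_comm]; exact hφ b)
  have hθc : 0 ≤ μ * (F.P K).d * Real.exp (μ * (F.P K).d) / β := by positivity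
  exact hVconj₂_of_letters_DeltaEtaSlot F h c₀ cB hε₀ hε hε12 U₀ hreg ha (fun x => Real.exp (φ x)) (fun _ => Real.exp_pos _) hρ hρ' xr
    (fun c b hb => readSet_ratio_exp_le F h φ hμ hφ' xr hxr c b hb) hθc hCk hνμ
    (fun x x' => far_ratio_exp_le F φ hμ hφ' hβ hβ1 x x') hk hQ

/-- ★★★ **THE BILINEAR LETTER, UNIFORMLY OVER THE FINE-LIPSCHITZ PHASE CLASS** (the bilinear twin of A2g ✓`hVconj_phaseClass_of_letters`, SAME constant).  `RegPr F n K ε₀ U₀` + routeR-w4's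
windows; `0 ≤ a`; `0 ≤ r < μ′`; `hk` (`Ck`, `μ′`), `hQ` (`C_Q`).  THEN for every `φ` with `|φ x − φ x′| ≤ r·η·tdist x x′` and all `X′`, `X″`, at `Δx := DeltaEtaSlot` and the weight `e^{φ∘src}`:
B2's bilinear letter with `θ₂(r) = a·(2√κ²C_Q + κ²) + √2·Ck·(r·d·e^{rd}∕β)·(d·(L^d)^{K−n}·(2(1+1∕(μ′−(r+β))))³) + 32√2·ε₀·d·6^d·(1 + e^{2r})`, `κ² = 216(e^{r(d+1)}−1)²(cB∕(c₀ℓ³))`,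
`β = min 1 ((μ′−r)∕2)` — independent of `φ` and of `K` at the pins. [cite: Balaban1985BackgroundPropagators, Thm 3.1 (3.46) p.398, (3.49) p.399, (3.132) p.422; Agmon1982, Ch. 1] -/
theorem hVconj₂_phaseClass_of_letters {ε₀ : ℝ} (hε₀ : 0 < ε₀) (hε : 10 ^ 10 * (F.L : ℝ) ^ 6 * ε₀ ≤ 1) (hε12 : 10 ^ 12 * (F.L : ℝ) ^ 3 * ε₀ ≤ 1)
    (U₀ : GaugeField (F.P K) 0 (Matrix.specialUnitaryGroup (Fin 2) ℂ)) (hreg : RegPr F n K ε₀ U₀) (ha : 0 ≤ a)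
    {r μ' Ck : ℝ} (hr : 0 ≤ r) (hrμ : r < μ') (hCk : 0 ≤ Ck)
    (hk : ∀ (b : PBond (F.P K) 0) (Z : Matrix (Fin 2) (Fin 2) ℂ) (bd : PBond (F.P K) 0),
      ‖(toL2 F K c₀).symm (DL2 F n K c₀ U₀ (DstarL2 F n K c₀ U₀ (toL2 F K c₀ (Pi.single b Z)) - RS F n K h c₀ cB U₀ (DstarL2 F n K c₀ U₀ (toL2 F K c₀ (Pi.single b Z))))) bd‖
        ≤ Ck * Real.exp (-(μ' * (Site.tdist (P := F.P K) (iterBlockOf (K - n) b.src) (iterBlockOf (K - n) bd.src) : ℝ))) * ‖Z‖)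
    {CQ : ℝ} (hQ : ∀ v : BondL2K ℂ 3 (periodsT3 F K) c₀ W₂, ‖Qk F n K h c₀ cB U₀ v‖ ≤ CQ * ‖v‖) :
    ∀ φ : Site (F.P K) 0 → ℝ, (∀ x x' : Site (F.P K) 0, |φ x - φ x'| ≤ r * eta F n K * (Site.tdist x x' : ℝ)) →
    ∀ X' X'' : PBond (F.P K) 0 → Matrix (Fin 2) (Fin 2) ℂ,
      |RCLike.re ((⟪toL2 F K c₀ (fun b => Real.exp (φ b.src) • X' b),
              laplaceA F n K h c₀ cB a (DeltaEtaSlot F n K c₀) U₀ (toL2 F K c₀ (fun b => (Real.exp (φ b.src))⁻¹ • X'' b))⟫_ℂ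
            - ∑ κ : Fin (F.P K).d, ⟪DL2 F n K c₀ U₀ (toL2S F K c₀ (formComp (fun b => Real.exp (φ b.src) • X' b) κ)),
                DL2 F n K c₀ U₀ (toL2S F K c₀ (formComp (fun b => (Real.exp (φ b.src))⁻¹ • X'' b) κ))⟫_ℂ)
          - (⟪toL2 F K c₀ X', laplaceA F n K h c₀ cB a (DeltaEtaSlot F n K c₀) U₀ (toL2 F K c₀ X'')⟫_ℂ
            - ∑ κ : Fin (F.P K).d, ⟪DL2 F n K c₀ U₀ (toL2S F K c₀ (formComp X' κ)), DL2 F n K c₀ U₀ (toL2S F K c₀ (formComp X'' κ))⟫_ℂ))|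
        ≤ (a * (2 * Real.sqrt (216 * (Real.exp (r * ((F.P K).d + 1)) - 1) ^ 2 * (cB / (c₀ * ((F.L : ℝ) ^ (K - n)) ^ 3))) * CQ
                  + 216 * (Real.exp (r * ((F.P K).d + 1)) - 1) ^ 2 * (cB / (c₀ * ((F.L : ℝ) ^ (K - n)) ^ 3)))
              + Real.sqrt 2 * Ck * (r * (F.P K).d * Real.exp (r * (F.P K).d) / min 1 ((μ' - r) / 2))
                  * (((F.P K).d : ℝ) * ((((F.P K).L : ℝ) ^ (F.P K).d) ^ (K - n)) * (2 * (1 + 1 / (μ' - (r + min 1 ((μ' - r) / 2))))) ^ 3)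
              + 32 * Real.sqrt 2 * ε₀ * (((F.P K).d : ℝ) * (2 * 3) ^ (F.P K).d) * (1 + Real.exp (2 * r)))
          * ‖toL2 F K c₀ X'‖ * ‖toL2 F K c₀ X''‖ := by
  intro φ hφ' X' X''
  have hη : 0 < eta F n K := eta_pos F n K
  have hη1 : eta F n K ≤ 1 := eta_le_one F (n := n) (K := K)
  obtain ⟨hβ, hβ1, hνμ⟩ := beta_rows (r := r) (μ' := μ') hrμ
  have hφ : ∀ b : PBond (F.P K) 0, |φ b.tgt - φ b.src| ≤ r * eta F n K := fun b => by
    have h1 := hφ' b.tgt b.src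
    have h2 : (Site.tdist b.tgt b.src : ℝ) ≤ 1 := by
      rw [tdist_comm]; exact_mod_cast tdist_src_tgt_le_one b
    calc |φ b.tgt - φ b.src| ≤ r * eta F n K * (Site.tdist b.tgt b.src : ℝ) := h1
      _ ≤ r * eta F n K * 1 := mul_le_mul_of_nonneg_left h2 (mul_nonneg hr hη.le)
      _ = r * eta F n K := mul_one _
  have hmain := hVconj₂_exp_of_letters_DeltaEtaSlot F h c₀ cB (a := a) hε₀ hε hε12 U₀ hreg ha φ hr hφ hφ'
    (fun c => Site.fibreSite 0 (K - n) (bondShift (sites_eq F n K h) c).src fun _ => (⟨0, pow_pos (F.P K).L_pos (K - n)⟩ : Fin ((F.P K).L ^ (K - n))))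
    (fun c => iterBlockOf_src_corner F h c) hβ hβ1 hνμ hCk hk hQ X' X''
  -- majorise the `η`-dependent local constant: `(1 + (e^{rη} − 1))² = e^{2rη} ≤ e^{2r}`
  have hloc : (1 + (1 + (Real.exp (r * eta F n K) - 1)) ^ 2) ≤ 1 + Real.exp (2 * r) := by
    have e1 : (1 + (Real.exp (r * eta F n K) - 1)) ^ 2 = Real.exp (2 * (r * eta F n K)) := by
      rw [add_sub_cancel, ← Real.exp_nat_mul]; norm_num
    rw [e1]
    have : 2 * (r * eta F n K) ≤ 2 * r := by nlinarith
    linarith [Real.exp_le_exp.mpr this]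
  have hX0 : 0 ≤ ‖toL2 F K c₀ X'‖ * ‖toL2 F K c₀ X''‖ := by positivity
  have hC0 : 0 ≤ 32 * Real.sqrt 2 * ε₀ * (((F.P K).d : ℝ) * (2 * 3) ^ (F.P K).d) := by positivity
  have hmono := mul_le_mul_of_nonneg_left hloc hC0
  refine hmain.trans ?_
  rw [mul_assoc, mul_assoc _ (‖toL2 F K c₀ X'‖)]
  exact mul_le_mul_of_nonneg_right (add_le_add le_rfl hmono) hX0

end Summit.QuantumFields.YangMills.Theorems.Prop7OneFormAgmonBilinearPhaseClass

end
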